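import Literature.AlgebraicGeometry.CubicSurfaces.LinesOrthogonalRep
import Mathlib.Tactic.DeriveFintype
import Mathlib.Algebra.BigOperators.Fin
import Mathlib.Data.Fin.VecNotation
import Mathlib.LinearAlgebra.BilinearForm.Orthogonal
import Mathlib.LinearAlgebra.BilinearForm.Hom
import Mathlib.LinearAlgebra.Dimension.StrongRankCondition
import Mathlib.LinearAlgebra.Charpoly.ToMatrix
import HarnessLib

/-!
# Marked lines of a cubic surface: the Schläfli graph and the frame of `V(F)`

This file proves the **linear-algebra half of the theorem of the `27` lines** as it enters the
occult residual representation (`CubicSurface.IsOccultSystem`, clause (3), and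
`CubicSurface.linesOrthogonalRep`): from a *marking* of the lines of a cubic form `F` — a
bijection of `CubicSurface.lines K F` with the `27` symbols `E_i, G_j, F_{ij}` under which the
intersection numbers `CubicSurface.interNum` are the Lorentzian products of the classical classes
in `Pic ≅ ℤ^{1,6}` — we construct an explicit orthonormal-type frame of the quadratic `𝔽₃`-space
`V(F) = N / rad N` (`CubicSurface.LinesQuadSpace`) and prove `dim V(F) = 5`.

## The mathematics and the sources

* [Hartshorne1977, V Prop 4.8, Thm 4.9, Rem 4.10.1]: a smooth cubic surface `S ⊆ ℙ³` over an
  algebraically closed field is `ℙ²` blown up in six points, `Pic S = ℤl ⊕ ℤe₁ ⊕ ⋯ ⊕ ℤe₆` with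
  `l² = 1`, `e_i² = -1`, `l·e_i = e_i·e_j = 0`; it contains exactly `27` lines, of classes
  `E_i = e_i` (six), `F_{ij} = l - e_i - e_j` (fifteen), `G_j = 2l - Σ_{i ≠ j} e_i` (six), each
  of self-intersection `-1`, two distinct lines meeting (with intersection number `1`) or skew
  (`0`) as computed in `Pic S`; the hyperplane class is `h = -K_S = 3l - Σ e_i`, `h·L = 1`.
* [Achter2014, §2]: the graph `Λ₀` on the `27` symbols `e_i, c_i, ℓ_{jk}` (`e_i ~ c_j` iff `i ≠ j`;
  `e_i, c_i ~ ℓ_{jk}` iff `i ∈ {j,k}`; `ℓ_{ij} ~ ℓ_{km}` iff `{i,j} ∩ {k,m} = ∅`) is the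
  intersection graph of the lines, and a **marking** of a cubic surface `Y` is a graph
  isomorphism `Λ(Y) → Λ₀`; the set of markings is a `W(E₆)`-torsor.
* [Achter2014, Lemma 4.4]: for a marked cubic surface the five classes
  `v_i = [e_i] - [ℓ_{i6}]`, `1 ≤ i ≤ 5`, form an **orthonormal basis** of the `5`-dimensional
  quadratic `𝔽₃`-space `P[1 - ζ₃]` (`≅ V(S)`, [AllcockCarlsonToledo2002, (4.8)–(4.10)]).
* [AllcockCarlsonToledo2002, (4.8)]: `V(S) = L₀(S)/3L₀'(S)`, `L₀(S) = h^⊥ ≅ -E₆`, is a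
  nondegenerate quadratic `𝔽₃`-space of dimension `5` (Bourbaki, *Lie* VI §4 Ex. 2).

## What is formalized (all proved, no hypotheses beyond the marking)

* `CubicSurface.SchlafliIdx` — the `27` symbols (`E i`, `G j`, `F i j (i < j)`, indices in
  `Fin 6`), `SchlafliIdx.cls` their classes in `ℤ⁷ = ℤl ⊕ ℤe₀ ⊕ ⋯ ⊕ ℤe₅`, `lorInt` the
  Lorentzian product, `hypInt` the hyperplane class; the classical tables are certified by
  `decide`: `lorInt_cls_self` (`L² = -1`), `lorInt_cls_hypInt` (`L·h = 1`),
  `lorInt_cls_cls_of_ne` (distinct lines have intersection number `0` or `1`),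
  `card_schlafliIdx` (`27`).
* `CubicSurface.SchlafliMarking K F` — a marking of the lines of `F` over `K`
  (`lines K F ≃ SchlafliIdx` with `interNum = lorInt` of the classes), and the constructor
  `SchlafliMarking.ofGraphIso` from Achter's graph-isomorphism formulation.
* Consequences of a marking `m`: `m.finite_lines`, `m.natCard_lines` (`= 27`);
  `m.interFormMod3_eq` (the mod-`3` intersection form is the pull-back of the Lorentzian form
  along the class map `𝔽₃^{(lines)} → 𝔽₃⁷`), `m.aug_eq` (`aug = (h̄, ·)`);
  the frame `m.frameVec i = [E_i] - [F_{i5}]` (`i : Fin 5`) with Gram matrix `-1`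
  (`m.linesQuadForm_frameVec`), linearly independent and spanning (`m.span_frameVec`, by an
  explicit reduction table `SchlafliIdx.coef`, `SchlafliIdx.dcoef` modulo the radical direction
  `h̄`), hence a basis `m.basis` of `V(F)`, **`finrank V(F) = 5`** (`m.finrank_linesQuadSpace`),
  and an orthonormal-type frame `m.lineFrame : LineFrame K F` of scale `-1`; in particular
  the hypothesis of `CubicSurface.linesOrthogonalRep_eq` holds (`m.linesOrthogonalRep_hyp`).
* Transport by a group `G` acting on `K` by `k`-automorphisms (section `Action`): the induced
  permutation of the `27` symbols `m.perm : G →* Equiv.Perm SchlafliIdx` preserves the Schläfli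
  configuration (`m.lorInt_cls_perm`, i.e. lands in `Aut(Λ₀) = W(E₆)` [Achter2014, §2]),
  markings are transported (`m.smul`), and the matrix of `σ` on `V(F)` in the marked frame is
  the explicit `frameMatrix (m.perm σ)` (`m.toMatrix_linesQuadRep`, `m.matrixRep_lineFrame`);
  hence the characteristic polynomial of `σ` on `V(F)` in any basis — the quantity in clause (3)
  of `CubicSurface.IsOccultSystem` — is `(frameMatrix (m.perm σ)).charpoly`
  (`m.charpoly_toMatrix_linesQuadRep_of_basis`) and depends only on the permutation of the
  lines (`m.charpoly_toMatrix_linesQuadRep_congr`).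

NOT here: the existence of a marking for a smooth cubic form over an algebraically closed field
(the theorem of the `27` lines proper, [Hartshorne1977, V Thm 4.9]); with it, `m.basis` is the
basis `b` required by clause (3) of `CubicSurface.IsOccultSystem`.

## References

* [Hartshorne1977] R. Hartshorne, *Algebraic Geometry*, GTM 52 (1977), V Prop 4.8, Thm 4.9,
  Rem 4.10.1.
* [Achter2014] J. Achter, *Arithmetic Torelli maps for cubic surfaces and threefolds*, Trans.
  AMS 366 (2014), §2 (markings, the graph `Λ₀`), Lemma 4.4 (the orthonormal basis).
* [AllcockCarlsonToledo2002] D. Allcock, J. Carlson, D. Toledo, *The complex hyperbolic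
  geometry of the moduli space of cubic surfaces*, J. Algebraic Geom. 11 (2002), (4.8)–(4.10).
-/

noncomputable section

open scoped Matrix
open Module

namespace Literature.AlgebraicGeometry.CubicSurfaces

namespace CubicSurface

/-! ### The 27 symbols, their classes in `ℤ^{1,6}`, and the classical tables -/

/-- The `27` symbols labelling the lines of a marked cubic surface, after the description of a
smooth cubic surface as `ℙ²` blown up in six points `P₀,…,P₅`: `E i` the exceptional curve over
`P_i`, `G j` the strict transform of the conic through the five points other than `P_j`, and
`F i j` (`i < j`) the strict transform of the line `P_i P_j` (Achter's `e_i`, `c_j`, `ℓ_{ij}`).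
Ref: Hartshorne (1977), V Thm 4.9; Achter (2014), §2. [cite: Hartshorne1977, V Thm 4.9] -/
inductive SchlafliIdx : Type
  /-- the exceptional curve `E_i` -/
  | E (i : Fin 6)
  /-- the conic `G_j` through the five points other than `P_j` -/
  | G (j : Fin 6)
  /-- the line `F_{ij}` through `P_i` and `P_j`, `i < j` -/
  | F (i j : Fin 6) (h : i < j)
  deriving DecidableEq, Fintype

/-- There are `27` symbols (`6 + 6 + 15`). [cite: Hartshorne1977, V Thm 4.9] -/
theorem card_schlafliIdx : Fintype.card SchlafliIdx = 27 := by decide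

namespace SchlafliIdx

/-- The class of a line in `Pic S = ℤl ⊕ ℤe₀ ⊕ ⋯ ⊕ ℤe₅ ≅ ℤ⁷` (coordinate `0` is `l`, coordinate
`k + 1` is `e_k`): `E_i = e_i`, `G_j = 2l - Σ_{i ≠ j} e_i`, `F_{ij} = l - e_i - e_j`.
Ref: Hartshorne (1977), V Thm 4.9. [cite: Hartshorne1977, V Thm 4.9] -/
def cls : SchlafliIdx → Fin 7 → ℤ
  | E i => fun k => if k = i.succ then 1 else 0
  | G j => fun k => if k = 0 then 2 else if k = j.succ then 0 else -1
  | F i j _ => fun k => if k = 0 then 1 else if k = i.succ ∨ k = j.succ then -1 else 0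

end SchlafliIdx

/-- The Lorentzian intersection product of `Pic S ≅ ℤ^{1,6}` in the coordinates
`(l; e₀, …, e₅)`: `l² = 1`, `e_k² = -1`, all other products `0`.
Ref: Hartshorne (1977), V Prop 4.8. [cite: Hartshorne1977, V Prop 4.8] -/
def lorInt (x y : Fin 7 → ℤ) : ℤ :=
  x 0 * y 0 - (x 1 * y 1 + x 2 * y 2 + x 3 * y 3 + x 4 * y 4 + x 5 * y 5 + x 6 * y 6)

/-- The hyperplane class `h = -K_S = 3l - Σ e_k`. Ref: Hartshorne (1977), V Prop 4.8.
[cite: Hartshorne1977, V Prop 4.8] -/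
def hypInt : Fin 7 → ℤ := ![3, -1, -1, -1, -1, -1, -1]

namespace SchlafliIdx

/-- Every line has degree one: `L · h = 1`. [cite: Hartshorne1977, V Thm 4.9] -/
theorem lorInt_cls_hypInt (a : SchlafliIdx) : lorInt (cls a) hypInt = 1 := by
  revert a; decide

/-- Every line has self-intersection `-1`. [cite: Hartshorne1977, V Thm 4.9] -/
theorem lorInt_cls_self (a : SchlafliIdx) : lorInt (cls a) (cls a) = -1 := by
  revert a; decide

/-- Two distinct lines are skew (`0`) or meet with intersection number `1`; the pairs with
product `1` are the edges of the Schläfli graph `Λ₀`. [cite: Hartshorne1977, V Rem 4.10.1] -/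
theorem lorInt_cls_cls_of_ne {a b : SchlafliIdx} (h : a ≠ b) :
    lorInt (cls a) (cls b) = 0 ∨ lorInt (cls a) (cls b) = 1 := by
  revert a b; decide

/-- The integral frame vectors `E_i - F_{i5}` (`i : Fin 5`; Achter's `[e_i] - [ℓ_{i6}]`), of class
`2e_i + e_5 - l`. Ref: Achter (2014), Lemma 4.4. [cite: Achter2014, Lemma 4.4] -/
def frameInt (i : Fin 5) : Fin 7 → ℤ :=
  cls (E i.castSucc) - cls (F i.castSucc (Fin.last 5) (Fin.castSucc_lt_last i))

/-- The Gram matrix of the frame vectors is `-4 · 1` (so `-1` modulo `3`: an orthonormal-type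
frame). Ref: Achter (2014), Lemma 4.4. [cite: Achter2014, Lemma 4.4] -/
theorem lorInt_frameInt (i j : Fin 5) :
    lorInt (frameInt i) (frameInt j) = if i = j then -4 else 0 := by
  revert i j; decide

/-- The frame vectors are orthogonal to the hyperplane class. [cite: Achter2014, Lemma 4.4] -/
theorem lorInt_frameInt_hypInt (i : Fin 5) : lorInt (frameInt i) hypInt = 0 := by
  revert i; decide

/-- Reduction table, coefficients: modulo `3` and modulo the radical direction `h̄`, the
difference `[L] - [E_5]` is `Σ_i coef L i · (E_i - F_{i5})` (see `cls_sub_cls_table`). [folklore] -/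
def coef : SchlafliIdx → Fin 5 → ℤ
  | E i => fun j => if i = Fin.last 5 then 0 else if j.castSucc = i then 1 else -1
  | F i b _ => fun j => if b = Fin.last 5 then (if j.castSucc = i then 0 else -1)
      else (if j.castSucc = i ∨ j.castSucc = b then 1 else 0)
  | G l => fun j => if l = Fin.last 5 then -1 else if j.castSucc = l then 0 else 1

/-- Reduction table, multiple of `h̄`: see `cls_sub_cls_table`. [folklore] -/
def dcoef : SchlafliIdx → ℤ
  | E i => if i = Fin.last 5 then 0 else 1
  | F _ b _ => if b = Fin.last 5 then 1 else 0
  | G l => if l = Fin.last 5 then -1 else 0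

/-- **Reduction table.** For every symbol `L`,
`[L] - [E_5] ≡ Σ_i coef L i · (E_i - F_{i5}) + dcoef L · h (mod 3)` coordinatewise in `ℤ⁷`:
the differences of lines lie, modulo `3` and modulo `𝔽₃ h̄`, in the span of the five frame
vectors (`h^⊥/3 = 𝔽₃ h̄ ⊕ ⟨frame⟩`, `dim V = 5`). Certified by `decide`.
[cite: AllcockCarlsonToledo2002, (4.8)] -/
theorem cls_sub_cls_table (a : SchlafliIdx) (k : Fin 7) :
    (cls a k - cls (E (Fin.last 5)) k - (coef a 0 * frameInt 0 k + coef a 1 * frameInt 1 k +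
      coef a 2 * frameInt 2 k + coef a 3 * frameInt 3 k + coef a 4 * frameInt 4 k) -
      dcoef a * hypInt k) % 3 = 0 := by
  revert a k; decide

end SchlafliIdx

/-! ### The Lorentzian form modulo `3` -/

/-- The Lorentzian form of `Pic S ⊗ 𝔽₃ = 𝔽₃⁷` (coordinates `(l; e₀,…,e₅)`).
[cite: AllcockCarlsonToledo2002, (4.8)] -/
def lorMod3 : LinearMap.BilinForm (ZMod 3) (Fin 7 → ZMod 3) :=
  LinearMap.mk₂ (ZMod 3)
    (fun x y => x 0 * y 0 - (x 1 * y 1 + x 2 * y 2 + x 3 * y 3 + x 4 * y 4 + x 5 * y 5 + x 6 * y 6))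
    (fun x x' y => by simp only [Pi.add_apply]; ring)
    (fun c x y => by simp only [Pi.smul_apply, smul_eq_mul]; ring)
    (fun x y y' => by simp only [Pi.add_apply]; ring)
    (fun c x y => by simp only [Pi.smul_apply, smul_eq_mul]; ring)

/-- Unfolding `lorMod3`. [folklore] -/
theorem lorMod3_apply (x y : Fin 7 → ZMod 3) : lorMod3 x y =
    x 0 * y 0 - (x 1 * y 1 + x 2 * y 2 + x 3 * y 3 + x 4 * y 4 + x 5 * y 5 + x 6 * y 6) := rfl

/-- `lorMod3` is symmetric. [folklore] -/
theorem lorMod3_comm (x y : Fin 7 → ZMod 3) : lorMod3 x y = lorMod3 y x := by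
  rw [lorMod3_apply, lorMod3_apply]; ring

/-- `lorMod3` is the reduction of `lorInt`. [folklore] -/
theorem lorMod3_intCast (x y : Fin 7 → ℤ) :
    lorMod3 (fun k => (x k : ZMod 3)) (fun k => (y k : ZMod 3)) = ((lorInt x y : ℤ) : ZMod 3) := by
  simp only [lorMod3_apply, lorInt, Int.cast_sub, Int.cast_add, Int.cast_mul]

namespace SchlafliIdx

/-- The class of a symbol modulo `3`. [folklore] -/
def clsMod3 (a : SchlafliIdx) (k : Fin 7) : ZMod 3 := (cls a k : ZMod 3)

/-- The frame vectors modulo `3`. [folklore] -/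
def frameMod3 (i : Fin 5) (k : Fin 7) : ZMod 3 := (frameInt i k : ZMod 3)

end SchlafliIdx

/-- The hyperplane class modulo `3`, `h̄ = -Σ ē_k`. [folklore] -/
def hypMod3 (k : Fin 7) : ZMod 3 := (hypInt k : ZMod 3)

namespace SchlafliIdx

/-- `frameMod3 i = clsMod3 (E i) - clsMod3 (F i 5)`. [folklore] -/
theorem frameMod3_eq (i : Fin 5) : frameMod3 i =
    clsMod3 (E i.castSucc) - clsMod3 (F i.castSucc (Fin.last 5) (Fin.castSucc_lt_last i)) := by
  funext k
  simp only [frameMod3, clsMod3, frameInt, Pi.sub_apply, Int.cast_sub]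

/-- `(h · L) mod 3 = 1`. [cite: Hartshorne1977, V Thm 4.9] -/
theorem lorMod3_hypMod3_clsMod3 (a : SchlafliIdx) : lorMod3 hypMod3 (clsMod3 a) = 1 := by
  rw [lorMod3_comm]
  show lorMod3 (fun k => ((cls a k : ℤ) : ZMod 3)) (fun k => ((hypInt k : ℤ) : ZMod 3)) = 1
  rw [lorMod3_intCast, lorInt_cls_hypInt, Int.cast_one]

/-- `(L · L') mod 3`. [folklore] -/
theorem lorMod3_clsMod3_clsMod3 (a b : SchlafliIdx) :
    lorMod3 (clsMod3 a) (clsMod3 b) = ((lorInt (cls a) (cls b) : ℤ) : ZMod 3) :=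
  lorMod3_intCast _ _

/-- The Gram matrix of the frame modulo `3` is `-1`: an orthonormal-type frame.
Ref: Achter (2014), Lemma 4.4. [cite: Achter2014, Lemma 4.4] -/
theorem lorMod3_frameMod3 (i j : Fin 5) :
    lorMod3 (frameMod3 i) (frameMod3 j) = if i = j then -1 else 0 := by
  show lorMod3 (fun k => ((frameInt i k : ℤ) : ZMod 3)) (fun k => ((frameInt j k : ℤ) : ZMod 3)) = _
  rw [lorMod3_intCast, lorInt_frameInt]
  split_ifs <;> decide

/-- The reduction table modulo `3`:
`clsMod3 L - clsMod3 (E 5) - Σ_i coef L i • frameMod3 i = dcoef L • h̄`.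
[cite: AllcockCarlsonToledo2002, (4.8)] -/
theorem clsMod3_sub_clsMod3_eq (a : SchlafliIdx) :
    clsMod3 a - clsMod3 (E (Fin.last 5)) - ∑ i : Fin 5, ((coef a i : ℤ) : ZMod 3) • frameMod3 i =
      ((dcoef a : ℤ) : ZMod 3) • hypMod3 := by
  funext k
  have h3 : (((cls a k - cls (E (Fin.last 5)) k - (coef a 0 * frameInt 0 k +
      coef a 1 * frameInt 1 k + coef a 2 * frameInt 2 k + coef a 3 * frameInt 3 k +
      coef a 4 * frameInt 4 k) - dcoef a * hypInt k : ℤ) : ZMod 3)) = 0 :=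
    (ZMod.intCast_zmod_eq_zero_iff_dvd _ 3).2 (Int.dvd_of_emod_eq_zero (cls_sub_cls_table a k))
  rw [Pi.sub_apply, Pi.sub_apply, Finset.sum_apply]
  simp only [Pi.smul_apply, smul_eq_mul, Fin.sum_univ_five, clsMod3, frameMod3, hypMod3]
  simp only [Int.cast_sub, Int.cast_add, Int.cast_mul] at h3
  linear_combination h3

end SchlafliIdx

/-! ### Markings -/

section Marking

variable {k : Type*} [Field k] (K : Type*) [Field K] [Algebra k K] (F : MvPolynomial (Fin 4) k)

/-- A **marking** of the lines of the cubic form `F` over `K` (Achter: a graph isomorphism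
`Λ(Y) → Λ₀`; Hartshorne: the labelling `E_i, F_{ij}, G_j` coming from a realisation of the
surface as `ℙ²` blown up in six points): a bijection of `lines K F` with the `27` symbols under
which the intersection numbers `interNum` (`-1` on the diagonal, `1`/`0` for meeting/skew
distinct lines) are the Lorentzian products of the classes in `Pic ≅ ℤ^{1,6}`.  Such a marking
exists when `F` is smooth and `K` is algebraically closed (theorem of the `27` lines, not
proved in this file); the set of markings is then a torsor under `W(E₆) = Aut(Λ₀)`.
Ref: Achter (2014), §2; Hartshorne (1977), V Thm 4.9, Rem 4.10.1.
[cite: Achter2014, §2] [cite: Hartshorne1977, V Thm 4.9] -/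
structure SchlafliMarking where
  /-- the labelling of the lines by the `27` symbols -/
  label : lines K F ≃ SchlafliIdx
  /-- intersection numbers are the Lorentzian products of the classes -/
  interNum_eq : ∀ ℓ ℓ' : lines K F,
    interNum K F ℓ ℓ' = lorInt (SchlafliIdx.cls (label ℓ)) (SchlafliIdx.cls (label ℓ'))

variable {K F}

namespace SchlafliMarking

/-- **Achter's formulation.** A bijection of the lines with the `27` symbols which is a graph
isomorphism onto `Λ₀` (two distinct lines meet iff the Lorentzian product of their labels' classes
is `1`) is a marking. Ref: Achter (2014), §2. [cite: Achter2014, §2] -/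
def ofGraphIso (e : lines K F ≃ SchlafliIdx)
    (h : ∀ ℓ ℓ' : lines K F, ℓ ≠ ℓ' →
      ((ℓ.1 ⊓ ℓ'.1 : Submodule K (Fin 4 → K)) ≠ ⊥ ↔
        lorInt (SchlafliIdx.cls (e ℓ)) (SchlafliIdx.cls (e ℓ')) = 1)) :
    SchlafliMarking K F where
  label := e
  interNum_eq ℓ ℓ' := by
    classical
    unfold interNum
    by_cases hll : ℓ = ℓ'
    · subst hll
      rw [if_pos rfl, SchlafliIdx.lorInt_cls_self]
    · rw [if_neg hll]
      have hne : e ℓ ≠ e ℓ' := fun h' => hll (e.injective h')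
      rcases SchlafliIdx.lorInt_cls_cls_of_ne hne with h0 | h1
      · rw [h0, if_neg]
        rw [h ℓ ℓ' hll, h0]
        decide
      · rw [h1, if_pos]
        rwa [h ℓ ℓ' hll]

/-- A marked cubic form has finitely many lines. [cite: Hartshorne1977, V Thm 4.9] -/
theorem finite_lines (m : SchlafliMarking K F) : (lines K F).Finite :=
  Set.finite_coe_iff.1 (Finite.of_equiv _ m.label.symm)

/-- A marked cubic form has exactly `27` lines. [cite: Hartshorne1977, V Thm 4.9] -/
theorem natCard_lines (m : SchlafliMarking K F) : Nat.card (lines K F) = 27 := by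
  rw [Nat.card_congr m.label, Nat.card_eq_fintype_card, card_schlafliIdx]

/-- The `Fintype` structure on the lines transported from the marking. [folklore] -/
abbrev fintypeLines (m : SchlafliMarking K F) : Fintype (lines K F) :=
  Fintype.ofEquiv _ m.label.symm

/-! #### The class map and the intersection form -/

/-- The class map `𝔽₃^{(lines)} → Pic ⊗ 𝔽₃ = 𝔽₃⁷`, `e_ℓ ↦ class(label ℓ) mod 3`.
[cite: AllcockCarlsonToledo2002, (4.8)] -/
def classMap (m : SchlafliMarking K F) : (lines K F →₀ ZMod 3) →ₗ[ZMod 3] (Fin 7 → ZMod 3) :=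
  Finsupp.linearCombination (ZMod 3) fun ℓ => SchlafliIdx.clsMod3 (m.label ℓ)

/-- `classMap (a e_ℓ) = a • clsMod3 (label ℓ)`. [folklore] -/
@[simp] theorem classMap_single (m : SchlafliMarking K F) (ℓ : lines K F) (a : ZMod 3) :
    m.classMap (Finsupp.single ℓ a) = a • SchlafliIdx.clsMod3 (m.label ℓ) := by
  rw [classMap, Finsupp.linearCombination_single]

/-- **The mod-3 intersection form is the pull-back of the Lorentzian form along the class map.**
[cite: AllcockCarlsonToledo2002, (4.8)] -/
theorem interFormMod3_eq (m : SchlafliMarking K F) (x y : lines K F →₀ ZMod 3) :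
    interFormMod3 K F x y = lorMod3 (m.classMap x) (m.classMap y) := by
  have h : interFormMod3 K F = lorMod3.compl₁₂ m.classMap m.classMap := by
    ext ℓ ℓ'
    simp only [LinearMap.coe_comp, Function.comp_apply, Finsupp.lsingle_apply,
      interFormMod3_single, LinearMap.compl₁₂_apply, classMap_single, one_smul, one_mul,
      SchlafliIdx.lorMod3_clsMod3_clsMod3, m.interNum_eq]
  exact LinearMap.congr_fun₂ h x y

/-- **The augmentation is the product with the hyperplane class**: `aug x = (h̄, classMap x)`
(every line has degree `1`). [cite: Hartshorne1977, V Thm 4.9] -/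
theorem aug_eq (m : SchlafliMarking K F) (x : lines K F →₀ ZMod 3) :
    aug K F x = lorMod3 hypMod3 (m.classMap x) := by
  have h : aug K F = (lorMod3 hypMod3) ∘ₗ m.classMap := by
    ext ℓ
    simp only [LinearMap.coe_comp, Function.comp_apply, Finsupp.lsingle_apply, aug_single,
      classMap_single, one_smul, SchlafliIdx.lorMod3_hypMod3_clsMod3]
  exact LinearMap.congr_fun h x

/-- **Radical criterion.** A sum-zero vector whose class is a multiple of `h̄` lies in the radical
of the form on `N` (`h̄` is orthogonal to `classMap N ⊆ h̄^⊥`).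
[cite: AllcockCarlsonToledo2002, (4.8)] -/
theorem mem_sumZeroRad_of_classMap_eq (m : SchlafliMarking K F) {x : sumZero K F} {d : ZMod 3}
    (hx : m.classMap (x : lines K F →₀ ZMod 3) = d • hypMod3) : x ∈ sumZeroRad K F := by
  rw [sumZeroRad, LinearMap.mem_ker]
  refine LinearMap.ext fun y => ?_
  have hy : aug K F (y : lines K F →₀ ZMod 3) = 0 := LinearMap.mem_ker.1 y.2
  rw [sumZeroForm, LinearMap.domRestrict₁₂_apply, LinearMap.zero_apply, m.interFormMod3_eq, hx,
    map_smul, LinearMap.smul_apply, ← m.aug_eq, smul_eq_mul, hy, mul_zero]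

/-! #### The frame -/

/-- The sum-zero vectors `e_{E_i} - e_{F_{i5}}`, `i : Fin 5` (Achter's `[e_i] - [ℓ_{i6}]`).
Ref: Achter (2014), Lemma 4.4. [cite: Achter2014, Lemma 4.4] -/
def frameFun (m : SchlafliMarking K F) (i : Fin 5) : sumZero K F :=
  ⟨Finsupp.single (m.label.symm (SchlafliIdx.E i.castSucc)) 1 -
      Finsupp.single (m.label.symm
        (SchlafliIdx.F i.castSucc (Fin.last 5) (Fin.castSucc_lt_last i))) 1, by
    rw [sumZero, LinearMap.mem_ker, map_sub, aug_single, aug_single, sub_self]⟩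

/-- Unfolding `frameFun`. [folklore] -/
@[simp] theorem coe_frameFun (m : SchlafliMarking K F) (i : Fin 5) :
    (m.frameFun i : lines K F →₀ ZMod 3) =
      Finsupp.single (m.label.symm (SchlafliIdx.E i.castSucc)) 1 -
        Finsupp.single (m.label.symm
          (SchlafliIdx.F i.castSucc (Fin.last 5) (Fin.castSucc_lt_last i))) 1 := rfl

/-- The class of `frameFun i` is `frameMod3 i = 2ē_i + ē_5 - l̄`. [folklore] -/
theorem classMap_frameFun (m : SchlafliMarking K F) (i : Fin 5) :
    m.classMap (m.frameFun i : lines K F →₀ ZMod 3) = SchlafliIdx.frameMod3 i := by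
  rw [coe_frameFun, map_sub, classMap_single, classMap_single, one_smul, one_smul,
    Equiv.apply_symm_apply, Equiv.apply_symm_apply, SchlafliIdx.frameMod3_eq]

/-- **The frame** of `V(F) = N / rad N`: the classes `[E_i] - [F_{i5}]`, `i : Fin 5`.
Ref: Achter (2014), Lemma 4.4. [cite: Achter2014, Lemma 4.4] -/
def frameVec (m : SchlafliMarking K F) (i : Fin 5) : LinesQuadSpace K F :=
  Submodule.Quotient.mk (m.frameFun i)

/-- **Orthonormality** (up to the sign `-1`): `q(b_i, b_j) = -δ_{ij}`.
Ref: Achter (2014), Lemma 4.4. [cite: Achter2014, Lemma 4.4] -/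
theorem linesQuadForm_frameVec (m : SchlafliMarking K F) (i j : Fin 5) :
    linesQuadForm K F (m.frameVec i) (m.frameVec j) = if i = j then -1 else 0 := by
  unfold frameVec
  rw [linesQuadForm_mk, m.interFormMod3_eq, classMap_frameFun, classMap_frameFun,
    SchlafliIdx.lorMod3_frameMod3]

/-- The frame is linearly independent (its Gram matrix `-1` is invertible).
[cite: Achter2014, Lemma 4.4] -/
theorem linearIndependent_frameVec (m : SchlafliMarking K F) :
    LinearIndependent (ZMod 3) m.frameVec := by
  refine (linesQuadForm K F).linearIndependent_of_iIsOrtho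
    (LinearMap.BilinForm.iIsOrtho_def.2 fun i j hij => ?_) fun i => ?_
  · rw [linesQuadForm_frameVec, if_neg hij]
  · rw [linesQuadForm_frameVec, if_pos rfl]
    decide

/-- The difference vectors `e_{label⁻¹ a} - e_{label⁻¹ (E 5)} ∈ N`, which span `N`. [folklore] -/
def diffFun (m : SchlafliMarking K F) (a : SchlafliIdx) : sumZero K F :=
  ⟨Finsupp.single (m.label.symm a) 1 -
      Finsupp.single (m.label.symm (SchlafliIdx.E (Fin.last 5))) 1, by
    rw [sumZero, LinearMap.mem_ker, map_sub, aug_single, aug_single, sub_self]⟩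

/-- Unfolding `diffFun`. [folklore] -/
@[simp] theorem coe_diffFun (m : SchlafliMarking K F) (a : SchlafliIdx) :
    (m.diffFun a : lines K F →₀ ZMod 3) =
      Finsupp.single (m.label.symm a) 1 -
        Finsupp.single (m.label.symm (SchlafliIdx.E (Fin.last 5))) 1 := rfl

/-- The class of `diffFun a`. [folklore] -/
theorem classMap_diffFun (m : SchlafliMarking K F) (a : SchlafliIdx) :
    m.classMap (m.diffFun a : lines K F →₀ ZMod 3) =
      SchlafliIdx.clsMod3 a - SchlafliIdx.clsMod3 (SchlafliIdx.E (Fin.last 5)) := by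
  rw [coe_diffFun, map_sub, classMap_single, classMap_single, one_smul, one_smul,
    Equiv.apply_symm_apply, Equiv.apply_symm_apply]

/-- **Reduction of differences of lines to the frame**: in `V(F)`,
`[e_L - e_{E_5}] = Σ_i coef L i • b_i` (the reduction table, the defect being a multiple of the
radical vector `h̄`). [cite: AllcockCarlsonToledo2002, (4.8)] -/
theorem mk_diffFun (m : SchlafliMarking K F) (a : SchlafliIdx) :
    (Submodule.Quotient.mk (m.diffFun a) : LinesQuadSpace K F) =
      ∑ i : Fin 5, ((SchlafliIdx.coef a i : ℤ) : ZMod 3) • m.frameVec i := by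
  have hmem : m.diffFun a - ∑ i : Fin 5, ((SchlafliIdx.coef a i : ℤ) : ZMod 3) • m.frameFun i ∈
      sumZeroRad K F := by
    refine m.mem_sumZeroRad_of_classMap_eq (d := ((SchlafliIdx.dcoef a : ℤ) : ZMod 3)) ?_
    rw [Submodule.coe_sub, Submodule.coe_sum, map_sub, map_sum]
    simp_rw [Submodule.coe_smul, map_smul, classMap_diffFun, classMap_frameFun]
    exact SchlafliIdx.clsMod3_sub_clsMod3_eq a
  have h := (Submodule.Quotient.mk_eq_zero (sumZeroRad K F)).2 hmem
  rw [Submodule.Quotient.mk_sub, sub_eq_zero] at h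
  rw [h, ← Submodule.mkQ_apply, map_sum]
  simp_rw [map_smul]
  rfl

/-- Every sum-zero vector is a combination of the difference vectors `diffFun`. [folklore] -/
theorem eq_sum_diffFun [Fintype (lines K F)] (m : SchlafliMarking K F) (x : sumZero K F) :
    x = ∑ ℓ : lines K F, (x : lines K F →₀ ZMod 3) ℓ • m.diffFun (m.label ℓ) := by
  have h1 : ∑ ℓ : lines K F, Finsupp.single ℓ ((x : lines K F →₀ ZMod 3) ℓ) = x :=
    Finsupp.univ_sum_single _
  have h2 : ∑ ℓ : lines K F, (x : lines K F →₀ ZMod 3) ℓ = 0 := by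
    have hx : aug K F (x : lines K F →₀ ZMod 3) = 0 := LinearMap.mem_ker.1 x.2
    rw [← h1, map_sum] at hx
    simpa only [aug_single] using hx
  apply Subtype.ext
  rw [Submodule.coe_sum]
  simp_rw [Submodule.coe_smul, coe_diffFun, Equiv.symm_apply_apply, smul_sub,
    Finset.sum_sub_distrib]
  rw [← Finset.sum_smul, h2, zero_smul, sub_zero]
  simp_rw [Finsupp.smul_single_one]
  exact h1.symm

/-- **The frame spans `V(F)`.** [cite: AllcockCarlsonToledo2002, (4.8)] -/
theorem span_frameVec (m : SchlafliMarking K F) :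
    ⊤ ≤ Submodule.span (ZMod 3) (Set.range m.frameVec) := by
  letI := m.fintypeLines
  rintro v -
  obtain ⟨x, rfl⟩ := Submodule.mkQ_surjective (sumZeroRad K F) v
  rw [m.eq_sum_diffFun x, map_sum]
  refine Submodule.sum_mem _ fun ℓ _ => ?_
  rw [map_smul]
  refine Submodule.smul_mem _ _ ?_
  rw [Submodule.mkQ_apply, mk_diffFun]
  exact Submodule.sum_mem _ fun i _ =>
    Submodule.smul_mem _ _ (Submodule.subset_span (Set.mem_range_self i))

/-- **The basis of `V(F)`** given by the frame `[E_i] - [F_{i5}]`, `i : Fin 5`.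
Ref: Achter (2014), Lemma 4.4. [cite: Achter2014, Lemma 4.4] -/
def basis (m : SchlafliMarking K F) : Basis (Fin 5) (ZMod 3) (LinesQuadSpace K F) :=
  Basis.mk m.linearIndependent_frameVec m.span_frameVec

/-- The basis vectors are the frame vectors. [folklore] -/
@[simp] theorem coe_basis (m : SchlafliMarking K F) : ⇑m.basis = m.frameVec := Basis.coe_mk _ _

/-- **`dim V(F) = 5`** for a marked cubic form (`V(S) = L₀(S)/3L₀'(S)`, `L₀ ≅ -E₆`).
Ref: Allcock–Carlson–Toledo (2002), (4.8). [cite: AllcockCarlsonToledo2002, (4.8)] -/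
theorem finrank_linesQuadSpace (m : SchlafliMarking K F) :
    finrank (ZMod 3) (LinesQuadSpace K F) = 5 := by
  simpa using finrank_eq_card_basis m.basis

/-- In the frame, `q` is `-1` times the sum-of-squares form:
`coords(x) · coords(y) = -q(x, y)`. [cite: Achter2014, Lemma 4.4] -/
theorem dotProduct_repr (m : SchlafliMarking K F) (x y : LinesQuadSpace K F) :
    ⇑(m.basis.repr x) ⬝ᵥ ⇑(m.basis.repr y) = -linesQuadForm K F x y := by
  have key : (Matrix.toBilin' (1 : Matrix (Fin 5) (Fin 5) (ZMod 3))).compl₁₂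
      m.basis.equivFun.toLinearMap m.basis.equivFun.toLinearMap = -linesQuadForm K F := by
    refine LinearMap.BilinForm.ext_basis m.basis fun i j => ?_
    rw [LinearMap.compl₁₂_apply, LinearMap.neg_apply, LinearMap.neg_apply, LinearEquiv.coe_coe,
      Basis.equivFun_apply, Basis.equivFun_apply, Basis.repr_self, Basis.repr_self,
      Matrix.toBilin'_apply', Matrix.one_mulVec, Finsupp.single_eq_pi_single,
      Finsupp.single_eq_pi_single, single_dotProduct, one_mul, Pi.single_apply, coe_basis,
      linesQuadForm_frameVec]
    split_ifs <;> decide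
  have h := LinearMap.congr_fun₂ key x y
  rw [LinearMap.compl₁₂_apply, LinearMap.neg_apply, LinearMap.neg_apply, LinearEquiv.coe_coe,
    Basis.equivFun_apply, Basis.equivFun_apply, Matrix.toBilin'_apply', Matrix.one_mulVec] at h
  exact h

/-- **The orthonormal-type frame of `V(F)` attached to a marking** (scale `-1`:
`coords · coords = -q`), Achter's orthonormal basis `[e_i] - [ℓ_{i6}]`.
Ref: Achter (2014), Lemma 4.4; Allcock–Carlson–Toledo (2002), (4.8).
[cite: Achter2014, Lemma 4.4] -/
def lineFrame (m : SchlafliMarking K F) : LineFrame K F where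
  basis := m.basis
  scale := -1
  compat x y := by rw [dotProduct_repr, Units.val_neg, Units.val_one, neg_one_mul]

/-- A marked cubic form admits a `LineFrame`. [cite: Achter2014, Lemma 4.4] -/
theorem nonempty_lineFrame (m : SchlafliMarking K F) : Nonempty (LineFrame K F) := ⟨m.lineFrame⟩

end SchlafliMarking

/-- For a cubic form whose lines over `k̄` are marked, the hypothesis of
`CubicSurface.linesOrthogonalRep_eq` holds: finitely many lines and a frame, so
`linesOrthogonalRep F` is the genuine mod-`3` orthogonal representation (not the junk value).
[cite: AllcockCarlsonToledo2002, (4.8)] -/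
theorem SchlafliMarking.linesOrthogonalRep_hyp
    (m : SchlafliMarking (AlgebraicClosure k) F) :
    (lines (AlgebraicClosure k) F).Finite ∧ Nonempty (LineFrame (AlgebraicClosure k) F) :=
  ⟨m.finite_lines, m.nonempty_lineFrame⟩

end Marking

/-! ### Transport of markings by automorphisms of `K/k`; the permutation of the 27 symbols

A group `G` acting on `K` by `k`-algebra automorphisms (e.g. `Gal(k̄/k)`) permutes the lines
(`CubicSurface.linesMulAction`) preserving intersection numbers (`interNum_smul`); through a
marking `m` this is a homomorphism `m.perm : G →* Equiv.Perm SchlafliIdx` into the automorphism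
group `Aut(Λ₀) = W(E₆)` of the Schläfli graph (`m.lorInt_cls_perm`), markings are transported
(`m.smul σ`, the `W(E₆)`-torsor structure of [Achter2014, §2]), and **the matrix of `σ` on `V(F)`
in the marked frame is an explicit function `frameMatrix` of the permutation `m.perm σ`**
(`m.toMatrix_linesQuadRep`, `m.matrixRep_lineFrame`): the mod-`3` orthogonal representation of
the lines factors through the action on the `27` symbols. -/

section Action

variable {k : Type*} [Field k] {K : Type*} [Field K] [Algebra k K] {F : MvPolynomial (Fin 4) k}
variable {G : Type*} [Group G] [MulSemiringAction G K] [SMulCommClass G k K]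

namespace SchlafliMarking

/-- The permutation of the `27` symbols induced by `σ ∈ G` through the marking,
`a ↦ label (σ • label⁻¹ a)`: a homomorphism `G →* Perm(Λ₀)`.
Ref: Achter (2014), §2 (`Aut(Λ₀) = W(E₆)`). [cite: Achter2014, §2] -/
def perm (m : SchlafliMarking K F) : G →* Equiv.Perm SchlafliIdx where
  toFun σ := m.label.symm.trans ((MulAction.toPerm σ).trans m.label)
  map_one' := by
    ext a
    simp only [Equiv.trans_apply, MulAction.toPerm_apply, one_smul, Equiv.apply_symm_apply,
      Equiv.Perm.coe_one, id_eq]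
  map_mul' σ τ := by
    ext a
    simp only [Equiv.trans_apply, MulAction.toPerm_apply, mul_smul, Equiv.Perm.coe_mul,
      Function.comp_apply, Equiv.symm_apply_apply]

/-- Unfolding `perm`. [folklore] -/
@[simp] theorem perm_apply (m : SchlafliMarking K F) (σ : G) (a : SchlafliIdx) :
    m.perm σ a = m.label (σ • m.label.symm a) := rfl

/-- `perm σ (label ℓ) = label (σ • ℓ)`. [folklore] -/
theorem perm_label (m : SchlafliMarking K F) (σ : G) (ℓ : lines K F) :
    m.perm σ (m.label ℓ) = m.label (σ • ℓ) := by
  rw [perm_apply, Equiv.symm_apply_apply]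

/-- `label⁻¹ (perm σ a) = σ • label⁻¹ a`. [folklore] -/
theorem label_symm_perm (m : SchlafliMarking K F) (σ : G) (a : SchlafliIdx) :
    m.label.symm (m.perm σ a) = σ • m.label.symm a := by
  rw [perm_apply, Equiv.symm_apply_apply]

/-- `perm σ = 1` iff `σ` fixes every line (then `σ` acts trivially on `V(F)`,
`CubicSurface.linesQuadRep_eq_one`). [folklore] -/
theorem perm_eq_one_iff (m : SchlafliMarking K F) (σ : G) :
    m.perm σ = 1 ↔ ∀ ℓ : lines K F, σ • ℓ = ℓ := by
  constructor
  · intro h ℓ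
    have h' := congrArg (fun π : Equiv.Perm SchlafliIdx => m.label.symm (π (m.label ℓ))) h
    simpa only [perm_label, Equiv.symm_apply_apply, Equiv.Perm.coe_one, id_eq] using h'
  · intro h
    ext a
    rw [perm_apply, h, Equiv.apply_symm_apply, Equiv.Perm.coe_one, id_eq]

/-- **`perm σ` is an automorphism of the Schläfli graph** (it preserves all Lorentzian products of
classes, i.e. lies in `Aut(Λ₀) = W(E₆)`), because `G` preserves intersection numbers.
Ref: Achter (2014), §2. [cite: Achter2014, §2] -/
theorem lorInt_cls_perm (m : SchlafliMarking K F) (σ : G) (a b : SchlafliIdx) :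
    lorInt (SchlafliIdx.cls (m.perm σ a)) (SchlafliIdx.cls (m.perm σ b)) =
      lorInt (SchlafliIdx.cls a) (SchlafliIdx.cls b) := by
  rw [perm_apply, perm_apply, ← m.interNum_eq, interNum_smul, m.interNum_eq,
    Equiv.apply_symm_apply, Equiv.apply_symm_apply]

/-- **Transport of a marking** by `σ ∈ G`: `label' ℓ = label (σ⁻¹ • ℓ)` (the set of markings is a
`W(E₆)`-torsor and `G` acts on it through `perm`). Ref: Achter (2014), §2. [cite: Achter2014, §2] -/
def smul (m : SchlafliMarking K F) (σ : G) : SchlafliMarking K F where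
  label := (MulAction.toPerm σ).symm.trans m.label
  interNum_eq ℓ ℓ' := by
    rw [Equiv.trans_apply, Equiv.trans_apply, MulAction.toPerm_symm_apply,
      MulAction.toPerm_symm_apply, ← m.interNum_eq, interNum_smul]

/-- Unfolding `smul`. [folklore] -/
@[simp] theorem smul_label (m : SchlafliMarking K F) (σ : G) (ℓ : lines K F) :
    (m.smul σ).label ℓ = m.label (σ⁻¹ • ℓ) := rfl

/-- The action on `N` moves the frame vector `e_{E_i} - e_{F_{i5}}` to the difference of the
difference vectors of the permuted symbols. [folklore] -/
theorem sumZeroRep_frameFun (m : SchlafliMarking K F) (σ : G) (i : Fin 5) :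
    sumZeroRep K F σ (m.frameFun i) =
      m.diffFun (m.perm σ (SchlafliIdx.E i.castSucc)) -
        m.diffFun (m.perm σ (SchlafliIdx.F i.castSucc (Fin.last 5) (Fin.castSucc_lt_last i))) := by
  apply Subtype.ext
  rw [Submodule.coe_sub, coe_diffFun, coe_diffFun, label_symm_perm, label_symm_perm, sub_sub_sub_cancel_right]
  show lineCombRep K F σ (m.frameFun i : lines K F →₀ ZMod 3) = _
  rw [coe_frameFun, map_sub, lineCombRep_single, lineCombRep_single]

/-- **The action of `σ` on the frame**, in the frame:
`σ • b_i = Σ_j (coef (perm σ (E i)) j - coef (perm σ (F i5)) j) • b_j`. [cite: Achter2014, §2] -/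
theorem linesQuadRep_frameVec (m : SchlafliMarking K F) (σ : G) (i : Fin 5) :
    linesQuadRep K F σ (m.frameVec i) =
      ∑ j : Fin 5, (((SchlafliIdx.coef (m.perm σ (SchlafliIdx.E i.castSucc)) j : ℤ) : ZMod 3) -
        ((SchlafliIdx.coef (m.perm σ
          (SchlafliIdx.F i.castSucc (Fin.last 5) (Fin.castSucc_lt_last i))) j : ℤ) : ZMod 3)) •
        m.frameVec j := by
  unfold frameVec
  rw [linesQuadRep_mk, sumZeroRep_frameFun, Submodule.Quotient.mk_sub, mk_diffFun, mk_diffFun,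
    ← Finset.sum_sub_distrib]
  simp_rw [sub_smul]
  rfl

/-- The matrix attached to a permutation `π` of the `27` symbols: entry `(i, j)` is
`coef (π (E j)) i - coef (π (F j5)) i` modulo `3` — for `π = perm σ` the matrix of `σ` on `V(F)`
in the marked frame (`toMatrix_linesQuadRep`). [folklore] -/
def frameMatrix (π : Equiv.Perm SchlafliIdx) : Matrix (Fin 5) (Fin 5) (ZMod 3) :=
  Matrix.of fun i j => ((SchlafliIdx.coef (π (SchlafliIdx.E j.castSucc)) i : ℤ) : ZMod 3) -
    ((SchlafliIdx.coef (π (SchlafliIdx.F j.castSucc (Fin.last 5) (Fin.castSucc_lt_last j))) i :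
      ℤ) : ZMod 3)

/-- The identity permutation gives the identity matrix (a sanity check of the reduction table
`SchlafliIdx.coef`). [folklore] -/
theorem frameMatrix_one : frameMatrix 1 = 1 := by
  decide

/-- **The mod-3 representation in the marked frame is `frameMatrix ∘ perm`**: the matrix of `σ`
on `V(F)` in the basis `[E_i] - [F_{i5}]` depends only on the permutation of the `27` symbols
induced by `σ`. [cite: Achter2014, §2] -/
theorem toMatrix_linesQuadRep (m : SchlafliMarking K F) (σ : G) :
    LinearMap.toMatrix m.basis m.basis (linesQuadRep K F σ) = frameMatrix (m.perm σ) := by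
  ext i j
  rw [LinearMap.toMatrix_apply, coe_basis, linesQuadRep_frameVec]
  have h := Basis.repr_sum_self m.basis fun i' => (((SchlafliIdx.coef (m.perm σ
      (SchlafliIdx.E j.castSucc)) i' : ℤ) : ZMod 3) - ((SchlafliIdx.coef (m.perm σ
      (SchlafliIdx.F j.castSucc (Fin.last 5) (Fin.castSucc_lt_last j))) i' : ℤ) : ZMod 3))
  rw [coe_basis] at h
  rw [h]
  rfl

/-- The same statement for the framed representation of `m.lineFrame`
(`LineFrame.matrixRep`). [cite: Achter2014, §2] -/
theorem matrixRep_lineFrame (m : SchlafliMarking K F) (σ : G) :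
    m.lineFrame.matrixRep σ = frameMatrix (m.perm σ) :=
  m.toMatrix_linesQuadRep σ

/-- In particular the matrices `frameMatrix (perm σ)` are orthogonal. [folklore] -/
theorem transpose_mul_frameMatrix_perm (m : SchlafliMarking K F) (σ : G) :
    (frameMatrix (m.perm σ))ᵀ * frameMatrix (m.perm σ) = 1 := by
  rw [← matrixRep_lineFrame]
  exact m.lineFrame.transpose_mul_matrixRep σ

/-- **Characteristic polynomials on `V(F)` factor through the `27` symbols**: in the marked frame
the characteristic polynomial of `σ` on `V(F)` — the quantity compared with Frobenius in the
residual clause of an occult system (`CubicSurface.IsOccultSystem`, clause (3)) — is the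
characteristic polynomial of `frameMatrix (perm σ)`. [cite: Achter2014, §2] -/
theorem charpoly_toMatrix_linesQuadRep (m : SchlafliMarking K F) (σ : G) :
    (LinearMap.toMatrix m.basis m.basis (linesQuadRep K F σ)).charpoly =
      (frameMatrix (m.perm σ)).charpoly := by
  rw [toMatrix_linesQuadRep]

/-- The same in **any** basis `b : Fin 5 → V(F)` (characteristic polynomials do not depend on the
basis), which is the form in which the residual clause of an occult system is stated. [folklore] -/
theorem charpoly_toMatrix_linesQuadRep_of_basis (m : SchlafliMarking K F)
    (b : Module.Basis (Fin 5) (ZMod 3) (LinesQuadSpace K F)) (σ : G) :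
    (LinearMap.toMatrix b b (linesQuadRep K F σ)).charpoly =
      (frameMatrix (m.perm σ)).charpoly := by
  haveI : Module.Finite (ZMod 3) (LinesQuadSpace K F) := Module.Finite.of_basis b
  rw [LinearMap.charpoly_toMatrix, ← LinearMap.charpoly_toMatrix _ m.basis,
    charpoly_toMatrix_linesQuadRep]

/-- In particular the characteristic polynomial of `σ` on `V(F)` in any basis depends only on the
permutation `perm σ` of the `27` symbols: two elements inducing the same permutation (e.g. elements
differing by one acting trivially on the lines) have the same characteristic polynomial.
[folklore] -/
theorem charpoly_toMatrix_linesQuadRep_congr (m : SchlafliMarking K F)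
    (b : Module.Basis (Fin 5) (ZMod 3) (LinesQuadSpace K F)) {σ τ : G}
    (h : m.perm σ = m.perm τ) :
    (LinearMap.toMatrix b b (linesQuadRep K F σ)).charpoly =
      (LinearMap.toMatrix b b (linesQuadRep K F τ)).charpoly := by
  rw [m.charpoly_toMatrix_linesQuadRep_of_basis, m.charpoly_toMatrix_linesQuadRep_of_basis, h]

end SchlafliMarking

end Action

end CubicSurface

end Literature.AlgebraicGeometry.CubicSurfaces

end
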